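import Mathlib.Analysis.Calculus.Deriv.Slope
import Literature.Geometry.Lorentzian.Stationary
import Literature.Geometry.Lorentzian.CausalityChronologyProofs
import Literature.Geometry.Lorentzian.NoncompactCauchyFutureSet
import Literature.Geometry.Lorentzian.ConvergenceTransport
import Literature.Topology.FourManifolds.RegularSublevelDeformation

/-!
# `ErgoregionBombModT` — no null membrane in the domain of outer communications
# (crux stmt-FinalStateConjecture-17838, line `killing-light-points`, certificate M1)

Route `ZeroEnergyKerrOrBomb` of the Final State Conjecture, crux
`Summit.FinalStateConjecture.FinalStateConjecture.Theses.ZeroEnergyKerrOrBomb.ErgoregionBombModT`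
(the ergoregion bomb modulo the stationary flow), line `killing-light-points`, idea card
`no-null-membranes-in-the-doc`, lemma M1 (the "one-way door").

Let `𝓑` be a stationary asymptotically flat black hole, `⟨⟨M_ext⟩⟩ = I⁺(M_ext) ∩ I⁻(M_ext)` its
domain of outer communications (Chruściel–Costa 2008, (2.2)), and `f` a `C¹` function which is
positive on `M_ext` and whose zero set inside `⟨⟨M_ext⟩⟩` is a *future null membrane*: at every
`x ∈ ⟨⟨M_ext⟩⟩` with `f x = 0` the differential is `df_x = g(L_x, ·)` for a null vector `L_x` in the
future timecone (`g(L_x, L_x) = 0`, `g(L_x, T_x) < 0` for the orienting field `T`).  Then `f ≥ 0`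
on all of `⟨⟨M_ext⟩⟩` (`noNullMembraneInDoc`): such a membrane can only be crossed from `{f > 0}`
to `{f < 0}` along a future timelike curve (at a crossing point `(f ∘ γ)' = g(L, γ') < 0`, a
future causal vector pairs negatively with a future timelike one, O'Neill 1983 Ch. 5 Lemma 5.29 and
p. 145), whereas a point `p ∈ ⟨⟨M_ext⟩⟩` with `f p < 0` is joined to `M_ext ⊆ {f > 0}` by a future
timelike curve `γ`, whose FIRST parameter `t₀` with `f (γ t₀) ≥ 0` is a crossing point in the wrong
direction — and `γ t₀` lies in `⟨⟨M_ext⟩⟩` (`p ≪ γ t₀ ≪ q ∈ M_ext`, transitivity of `≪`, O'Neill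
1983 Ch. 14 pp. 402–403), so the door hypothesis applies there.

References: B. O'Neill, *Semi-Riemannian geometry* (1983), Ch. 5 Lemma 5.29, p. 145; Ch. 14,
pp. 402–403; P. T. Chruściel, J. L. Costa, Astérisque 321 (2008), §2.2; crux workfiles
`Cruxes/ErgoregionBombModT/Ideas/killing-light-points.md`, `Lines/killing_light_points.lean`.
-/

noncomputable section

open Bundle Set Filter Function
open scoped Manifold Topology

-- summit = problem name (D-0017)
set_option linter.dupNamespace false

namespace Summit.FinalStateConjecture.FinalStateConjecture.Theorems.ErgoregionBombModT

open Literature.Geometry.Lorentzian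

/-- **No null membrane in the domain of outer communications (the one-way door, lemma M1 of
line `killing-light-points`).**  Let `f` be `C¹` on the spacetime of a stationary asymptotically
flat black hole `𝓑`, positive on `M_ext`, and such that at every zero `x ∈ ⟨⟨M_ext⟩⟩` of `f` the
differential is `df_x = g(L_x, ·)` with `L_x` null and `g(L_x, T_x) < 0` (`T` the orienting
field).  Then `0 ≤ f` on `⟨⟨M_ext⟩⟩ = I⁺(M_ext) ∩ I⁻(M_ext)`.  Proof: if `f p < 0` for some
`p ∈ ⟨⟨M_ext⟩⟩`, pick a future timelike `γ : [a, b] → M` from `p` to some `q ∈ M_ext`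
(`p ∈ I⁻(M_ext)`), and let `t₀` be the least parameter with `f (γ t₀) ≥ 0`; then `a < t₀ < b`,
`f (γ t₀) = 0` (intermediate value theorem), `f ∘ γ < 0` on `[a, t₀)`, and
`γ t₀ ∈ ⟨⟨M_ext⟩⟩` by transitivity of `≪` (O'Neill 1983, Ch. 14, pp. 402–403).  At `x = γ t₀` the
chain rule gives `(f ∘ γ)'(t₀) = df_x(γ' t₀) = g(L_x, γ' t₀) < 0`, since `L_x` is future causal
and `γ' t₀` future timelike (O'Neill 1983, Ch. 5, Lemma 5.29 and p. 145;
`TimeOrientation.IsFutureDirected.val_lt_zero`) — but the left difference quotients of `f ∘ γ` at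
`t₀` are positive.  Chruściel–Costa 2008, §2.2 for `⟨⟨M_ext⟩⟩`.
[cite: ONeillSemiRiemannian1983, Ch. 14, pp. 402–403] [cite: ChruscielCosta2008, §2.2] -/
theorem noNullMembraneInDoc : ∀ (𝓑 : Literature.Geometry.Lorentzian.StationaryAFBlackHole.{0}) (f : 𝓑.carrier → ℝ) (L : Π x : 𝓑.carrier, TangentSpace (𝓡 4) x), ContMDiff (𝓡 4) 𝓘(ℝ, ℝ) 1 f → (∀ x ∈ 𝓑.Mext, 0 < f x) → (∀ x ∈ 𝓑.doc, f x = 0 → (∀ w : TangentSpace (𝓡 4) x, mfderiv (𝓡 4) 𝓘(ℝ, ℝ) f x w = 𝓑.metric.val x (L x) w) ∧ 𝓑.metric.val x (L x) (L x) = 0 ∧ 𝓑.metric.val x (L x) (𝓑.timeOrientation.vectorField x) < 0) → ∀ p ∈ 𝓑.doc, 0 ≤ f p := by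
  intro 𝓑 f L hf hpos hdoor p hp
  by_contra hneg
  push Not at hneg
  -- `p ∈ I⁺(M_ext) ∩ I⁻(M_ext)`: a future timelike `γ : [a, b] → M` from `p` to some `q ∈ M_ext`
  have hpF : p ∈ 𝓑.metric.chronologicalFuture 𝓑.timeOrientation 𝓑.Mext := hp.1
  have hpP : p ∈ 𝓑.metric.chronologicalPast 𝓑.timeOrientation 𝓑.Mext := hp.2
  obtain ⟨q, hq, hqp⟩ := LorentzianMetric.mem_chronologicalPast_iff_exists.mp hpP
  obtain ⟨p', hp'p, γ, a, b, hab, hγ, hγa', hγb⟩ := hqp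
  have hγa : γ a = p := hγa'.trans (mem_singleton_iff.mp hp'p)
  -- `φ = f ∘ γ` is continuous on `[a, b]`, negative at `a`, positive at `b`
  set φ : ℝ → ℝ := fun t ↦ f (γ t) with hφ
  have hφa : φ a < 0 := by simp only [hφ, hγa]; exact hneg
  have hφb : 0 < φ b := by simp only [hφ, hγb]; exact hpos q hq
  have hcont : ContinuousOn φ (Icc a b) := fun t ht ↦
    (hf.continuous.continuousAt.comp (hγ t ht).1.continuousAt).continuousWithinAt
  -- `t₀`: the least parameter in `[a, b]` with `0 ≤ φ`
  set S : Set ℝ := Icc a b ∩ φ ⁻¹' (Ici 0) with hS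
  have hSc : IsClosed S := hcont.preimage_isClosed_of_isClosed isClosed_Icc isClosed_Ici
  have hbS : b ∈ S := ⟨right_mem_Icc.mpr hab.le, hφb.le⟩
  have hSne : S.Nonempty := ⟨b, hbS⟩
  have hSbdd : BddBelow S := ⟨a, fun t ht ↦ ht.1.1⟩
  set t₀ : ℝ := sInf S with ht₀
  have ht₀S : t₀ ∈ S := hSc.csInf_mem hSne hSbdd
  have ht₀ab : t₀ ∈ Icc a b := ht₀S.1
  have hφt₀ : 0 ≤ φ t₀ := ht₀S.2
  have hlt : ∀ t ∈ Ico a t₀, φ t < 0 := by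
    intro t ht
    by_contra h
    push Not at h
    have htS : t ∈ S := ⟨⟨ht.1, ht.2.le.trans ht₀ab.2⟩, h⟩
    exact (not_le.mpr ht.2) (csInf_le hSbdd htS)
  have hat₀ : a < t₀ := by
    rcases ht₀ab.1.eq_or_lt with h | h
    · rw [← h] at hφt₀
      exact absurd hφt₀ (not_le.mpr hφa)
    · exact h
  -- `φ t₀ = 0` (intermediate value theorem on `[a, t₀]`)
  have hφ0 : φ t₀ = 0 := by
    by_contra hne
    have hpos' : 0 < φ t₀ := lt_of_le_of_ne hφt₀ (Ne.symm hne)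
    obtain ⟨s, hs, hs0⟩ := intermediate_value_Icc hat₀.le
      (hcont.mono (Icc_subset_Icc_right ht₀ab.2)) ⟨hφa.le, hpos'.le⟩
    rcases hs.2.eq_or_lt with h | h
    · rw [h] at hs0
      exact hne hs0
    · exact (hlt s ⟨hs.1, h⟩).ne hs0
  have ht₀b : t₀ < b := by
    rcases ht₀ab.2.eq_or_lt with h | h
    · rw [h] at hφ0
      exact absurd hφ0 hφb.ne'
    · exact h
  -- `γ t₀ ∈ ⟨⟨M_ext⟩⟩`: `p ≪ γ t₀` with `p ∈ I⁺(M_ext)`, and `γ t₀ ≪ q ∈ M_ext`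
  have hx : γ t₀ ∈ 𝓑.doc := by
    refine ⟨?_, ?_⟩
    · exact LorentzianMetric.mem_chronologicalFuture_trans hpF
        ⟨p, rfl, γ, a, t₀, hat₀, hγ.mono (Icc_subset_Icc_right ht₀ab.2), hγa, rfl⟩
    · exact LorentzianMetric.mem_chronologicalPast_iff_exists.mpr
        ⟨q, hq, γ t₀, rfl, γ, t₀, b, ht₀b, hγ.mono (Icc_subset_Icc_left ht₀ab.1), rfl, hγb⟩
  obtain ⟨hdf, hLL, hLT⟩ := hdoor (γ t₀) hx hφ0
  -- the chain rule: `φ'(t₀) = df (γ' t₀) = g(L, γ' t₀)`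
  obtain ⟨hγd, hγt, hγf⟩ := hγ t₀ ht₀ab
  have hD : HasDerivAt φ
      (𝓑.metric.val (γ t₀) (L (γ t₀)) (mfderiv 𝓘(ℝ, ℝ) (𝓡 4) γ t₀ (1 : ℝ))) t₀ := by
    have h := Literature.Topology.FourManifolds.hasDerivAt_comp_of_mdifferentiableAt
      (hf.mdifferentiableAt one_ne_zero) hγd
    rw [hdf] at h
    exact h
  -- `g(L, γ' t₀) < 0`: `L` is future causal, `γ' t₀` future timelike
  have hL0 : L (γ t₀) ≠ 0 := by
    intro h0
    have h := hLT
    rw [h0, map_zero] at h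
    simp at h
  have hLfd : 𝓑.timeOrientation.IsFutureDirected (L (γ t₀)) :=
    ⟨⟨hLL.le, hL0⟩, by rw [𝓑.metric.symm]; exact hLT⟩
  have hDneg : 𝓑.metric.val (γ t₀) (L (γ t₀)) (mfderiv 𝓘(ℝ, ℝ) (𝓡 4) γ t₀ (1 : ℝ)) < 0 := by
    rw [𝓑.metric.symm]
    exact hγf.val_lt_zero 𝓑.timeOrientation hγt hLfd
  -- but the left difference quotients of `φ` at `t₀` are positive
  have hDnonneg :
      0 ≤ 𝓑.metric.val (γ t₀) (L (γ t₀)) (mfderiv 𝓘(ℝ, ℝ) (𝓡 4) γ t₀ (1 : ℝ)) := by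
    have htend := (hasDerivAt_iff_tendsto_slope_left_right.mp hD).1
    refine ge_of_tendsto htend ?_
    filter_upwards [Ioo_mem_nhdsLT hat₀] with t ht
    rw [slope_def_field, hφ0, sub_zero]
    exact (div_pos_of_neg_of_neg (hlt t ⟨ht.1.le, ht.2⟩) (sub_neg.mpr ht.2)).le
  exact absurd hDnonneg (not_le.mpr hDneg)

end Summit.FinalStateConjecture.FinalStateConjecture.Theorems.ErgoregionBombModT
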